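import Summits.BirchSwinnertonDyer.Rank1Residual.Partition.MainConjecturesSignedLowerDivisibility
import Summits.BirchSwinnertonDyer.Rank1Residual.Supersingular.KobayashiEquivalenceRankZero
import Summits.BirchSwinnertonDyer.Rank1Residual.Supersingular.SignedRankOneCorA5
import HarnessLib

/-!
# The supersingular residual classes at main-conjecture level, BOTH ranks, from ONE divisibility:
# X6 (and X7 on its surjective branch) ∧ {r_an ≤ 1} ⇒ `BSD(E,p)` ⇐ the Eisenstein half of
# Kobayashi's signed main conjecture for one sign + published facts

HONEST FRAMING (cell `b2b-bsdres`, run/shared/lean/b2b/bsd-rank1-residual/, verbatim in every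
file): the goal of the cell is to DELETE the COMBINATION-SHAPED residual classes of the
Birch–Swinnerton-Dyer formula for ALL analytic-rank `≤ 1` elliptic curves over `ℚ` — "full BSD
formula for every rank `≤ 1` curve in class `C`" assembled STRICTLY from published theorems — so
that the rank-`≤ 1` remainder becomes exactly the CONSTRUCTION-SHAPED classes, which are TYPED
(missing-input `Prop`s), NOT attempted. This is not "finishing BSD". Research routes; no claim
beyond the stated classes; nothing booked; no label changes (X6 / X7 stay CONSTRUCTION-SHAPED; the
typed input below is OPEN in print off CM / `a_p = 0`, announced for semistable `E` by BSTW
arXiv:2409.01350, PRE). THEOREMS ONLY (no definition, no named fact, no `sorry`); every published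
theorem enters as one of the tree's existing named Literature facts BY NAME; every unproved statement
enters as an EXPLICIT binder. Unit `b2b-bsdres-lit-glue` (GLUE seat), gen 10 — a leaf over this gen's
`MainConjecturesSignedLowerDivisibility.lean` (`Supersingular.kobayashiMainConjecture_of_lowerDivisibility_of_thm41`)
and x10b / additive-p3 / lit-cw's `Supersingular/KobayashiEquivalenceRankZero.lean`, `SignedRankOneCorA5.lean`.

## What this file records (namespace `Summit.BirchSwinnertonDyer.Rank1Residual.Supersingular`)

The cell's kernel had, per rank: rank `0` — `X6.bsdp_of_kobayashiLowerDivisibility_of_analyticRank_eq_zero`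
(ONE divisibility suffices: Wuthrich 2014 Prop. 21 is the other half); rank `1` —
`X6.bsdp_of_kobayashiMainConjecture_of_corA5_of_analyticRank_eq_one` (the EQUALITY, through BKO 2024
Cor. A.5). With this gen's "Eisenstein half + Kobayashi 2003 Thm. 4.1 ⇒ equality" the rank-`1`
input drops to the same ONE divisibility, so:

* `bsdp_of_lowerDivisibility_of_thm41_of_corA5_of_analyticRank_eq_one` — class-agnostic datum form:
  `p` odd good, `a_p = 0`, `ρ̄_{E,p}` onto, `r_an = 1`: `KobayashiLowerDivisibility W p ε` (one sign)
  + Kobayashi Thm. 1.2 / Thm. 4.1 + period unit + BKO Cor. A.5 + modularity + GZK ⇒ `BSD(E,p)`.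
* `X6.bsdp_of_lowerDivisibility_of_analyticRank_eq_one`, and the CLASS-LEVEL, BOTH-RANKS form
  **`X6.bsdp_of_lowerDivisibility`**: for EVERY X6 pair (semistable `E`, good supersingular odd `p`,
  `p ≥ 5 ∨ a_3 = 0`) with `r_an ≤ 1`, `BSD(E,p)` follows from ONE typed input — the Eisenstein
  inclusion `Char(X^ε(E/ℚ_∞)) ⊆ (L_p^ε(E))` for ONE sign `ε` (`KobayashiLowerDivisibility W p ε`) —
  and the published named facts Wuthrich 2014 Prop. 21 (`hW`), Kobayashi 2003 Thm. 1.2 (`h12`) /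
  Thm. 4.1 (`h41`), B. D. Kim 2013 Cor. 3.15 (`hKim`), BKO 2024 Cor. A.5 (`hA5`), the period unit
  (`h5`/`h3`), modularity (`hmodP`, `hmod`), GZK; Pollack 2003 and Wuthrich L. 20 are tree theorems.
  RESIDUAL-MAP §B N4 ("NEEDS X_B1") for both ranks, as ONE kernel statement.
* `X7.bsdp_of_lowerDivisibility_of_surj_of_analyticRank_eq_one`, **`X7.bsdp_of_lowerDivisibility_of_surj`**:
  the same on class X7 (good supersingular, NON-semistable) on its branch `ρ̄_{E,p}` onto ∧ `a_p = 0`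
  (`a_p = 0` is automatic at `p ≥ 5`; at `p = 3` the `a_3 = ±3` pairs are class X8), both ranks.
  RESIDUAL-MAP §B N5/O4 ("NEEDS X_B2") on the surjective branch, as ONE kernel statement; the
  non-surjective branch keeps the equality-shaped input (Thm. 4.1's integral clause needs the image).

References: [Kobayashi2003] Conjecture (p. 2), Thm. 1.2, Thm. 4.1 (p. 8); [Wuthrich2014] Prop. 21,
Lemma 20; [BDKim2013] Cor. 3.15; [BurungaleKobayashiOta2023] App. A Cor. A.5; [Pollack2003] Thm. 5.6;
RESIDUAL-MAP.md §B (N4, N5/O4); HOME/b2b-bsdres-lit-glue/GLUE.md GEN 10 ADDENDUM §G10.8.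
-/

set_option autoImplicit false

noncomputable section

open scoped Classical MatrixGroups ModularForm

open CongruenceSubgroup WeierstrassCurve Literature.NumberTheory.EllipticCurves
  Literature.NumberTheory.EllipticCurves.ModularForms
  Literature.NumberTheory.EllipticCurves.Rank1Residual
  Literature.NumberTheory.EllipticCurves.Rank1Residual.Typed
  Literature.NumberTheory.EllipticCurves.Kobayashi2003
  Literature.NumberTheory.EllipticCurves.BurungaleKobayashiOta2024 ZpExtension

namespace Summit.BirchSwinnertonDyer.Rank1Residual.Supersingular

variable (W : WeierstrassCurve ℚ) [W.IsElliptic] [W.IsGloballyMinimal] (p : ℕ) [Fact p.Prime]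

/-! ### Rank one: ONE divisibility + Kobayashi Thm. 4.1 + BKO Cor. A.5 -/

/-- **Rank one, class-agnostic: `BSD(E,p)` from the EISENSTEIN HALF of the signed main conjecture for
ONE sign.** Let `p` be an odd prime of good reduction of `E = W` (globally minimal) with `a_p = 0`,
`ρ̄_{E,p}` onto and `r_an = 1`. Granted BY NAME Kobayashi 2003 Thm. 1.2 (`h12`), Thm. 4.1 (`h41`,
the Kato half), the period unit (`h5`, `h3`), BKO 2024 Cor. A.5 (`hA5`: signed MC ⇒ rank-one
`p`-part), modularity (`hmod`), GZK (`hGZK`): `KobayashiLowerDivisibility W p ε ⇒ BSD(E,p)` —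
`kobayashiMainConjecture_of_lowerDivisibility_of_thm41` then
`bsdp_of_kobayashiMainConjecture_of_corA5_of_analyticRank_eq_one`.
[cite: Kobayashi2003, Conjecture (p. 2), Thm. 1.2, Thm. 4.1 (p. 8)]
[cite: BurungaleKobayashiOta2023, App. A Cor. A.5 and Thm. A.6] [cite: Miller2011LMS, Def. 1.1] -/
theorem bsdp_of_lowerDivisibility_of_thm41_of_corA5_of_analyticRank_eq_one
    (h12 : Kobayashi2003.thm12_signedSelmerDual_finite_torsion)
    (h41 : Kobayashi2003.thm41_signedCharIdeal_divisibility)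
    (h5 : realPeriodRat_eq_unit_mul_plusPeriod) (h3 : realPeriodRat_eq_unit_mul_plusPeriod_three)
    (hA5 : corA5_pPart_of_signedCharIdeal_eq) (hmod : hasEntireLFunction_rat)
    (hGZK : rank_eq_analyticRank_of_analyticRank_le_one)
    (hp : p ≠ 2) (hgood : W.HasGoodReductionAtPrime p) (hap : W.frobeniusTrace p = 0) (hs : Surj W p)
    (h1 : W.analyticRank = 1) (ε : ℤˣ) (hlow : KobayashiLowerDivisibility W p ε) : BSDp W p :=
  bsdp_of_kobayashiMainConjecture_of_corA5_of_analyticRank_eq_one W p hA5 hmod hGZK hp hgood hap h1 ε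
    (kobayashiMainConjecture_of_lowerDivisibility_of_thm41 h12 h41 h5 h3 W p hp hgood hap hs ε hlow)

/-- **X6 ∧ {r_an = 1}, odd `p`: `BSD(E,p)` from ONE divisibility for ONE sign** (`a_p = 0` and
`ρ̄_{E,p}` onto are automatic on X6: `ClassX6.frobeniusTrace_eq_zero`, `ClassX6.surj`).
[cite: Kobayashi2003, Conjecture (p. 2), Thm. 1.2, Thm. 4.1 (p. 8)] [cite: BurungaleKobayashiOta2023, App. A Cor. A.5]
[cite: Serre1972, §5.4 Prop. 21 i)] -/
theorem X6.bsdp_of_lowerDivisibility_of_analyticRank_eq_one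
    (h12 : Kobayashi2003.thm12_signedSelmerDual_finite_torsion)
    (h41 : Kobayashi2003.thm41_signedCharIdeal_divisibility)
    (h5 : realPeriodRat_eq_unit_mul_plusPeriod) (h3 : realPeriodRat_eq_unit_mul_plusPeriod_three)
    (hA5 : corA5_pPart_of_signedCharIdeal_eq) (hmod : hasEntireLFunction_rat)
    (hGZK : rank_eq_analyticRank_of_analyticRank_le_one)
    (hp : p ≠ 2) (hX : ClassX6 W p) (h1 : W.analyticRank = 1) (ε : ℤˣ)
    (hlow : KobayashiLowerDivisibility W p ε) : BSDp W p :=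
  bsdp_of_lowerDivisibility_of_thm41_of_corA5_of_analyticRank_eq_one W p h12 h41 h5 h3 hA5 hmod hGZK hp
    hX.1.1 (ClassX6.frobeniusTrace_eq_zero W p hp hX) (ClassX6.surj W p hp hX) h1 ε hlow

/-- **CLASS X6 AT MAIN-CONJECTURE LEVEL, BOTH RANKS, FROM ONE DIVISIBILITY.** For EVERY X6 pair — `E/ℚ`
semistable (globally minimal `W`), `p` an odd prime of good SUPERSINGULAR reduction, `p ≥ 5 ∨ a_3 = 0`
— with `r_an ≤ 1`: `BSD(E,p)` holds granted ONE typed input, the Eisenstein inclusion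
`Char(X^ε(E/ℚ_∞)) ⊆ (L_p^ε(E))` for ONE sign `ε` (`KobayashiLowerDivisibility W p ε`; OPEN in print,
announced BSTW Thm. 1.3), and the PUBLISHED named facts Wuthrich 2014 Prop. 21 (`hW`, rank `0` upper
half), Kobayashi 2003 Thm. 1.2 (`h12`) and Thm. 4.1 (`h41`, rank `1` Kato half), B. D. Kim 2013 Cor.
3.15 (`hKim`), BKO 2024 Cor. A.5 (`hA5`), the period unit (`h5`, `h3`), modularity (`hmodP`, `hmod`),
GZK (`hGZK`); Pollack 2003 (`pollack_exists_plusMinusPAdicLFunction_holds`) and Wuthrich L. 20 are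
tree theorems. Rank `0`: x10b's `X6.bsdp_of_kobayashiLowerDivisibility_of_analyticRank_eq_zero`;
rank `1`: `X6.bsdp_of_lowerDivisibility_of_analyticRank_eq_one`. RESIDUAL-MAP §B N4 + the X6 ∧ r = 1
cell as ONE kernel statement; X6 stays CONSTRUCTION-SHAPED (nothing booked).
[cite: Kobayashi2003, Conjecture (p. 2), Thm. 1.2, Thm. 4.1 (p. 8)] [cite: Wuthrich2014, Prop. 21 (p. 400)]
[cite: BDKim2013, Cor. 3.15 (p. 199)] [cite: BurungaleKobayashiOta2023, App. A Cor. A.5]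
[cite: Pollack2003, Thm. 5.6] [cite: Miller2011LMS, Def. 1.1] -/
theorem X6.bsdp_of_lowerDivisibility
    (hW : Wuthrich2014.sha_dvd_analyticSha)
    (h12 : Kobayashi2003.thm12_signedSelmerDual_finite_torsion)
    (h41 : Kobayashi2003.thm41_signedCharIdeal_divisibility)
    (hKim : BDKim2013.cor315_signedCharValue_rankZero)
    (hA5 : corA5_pPart_of_signedCharIdeal_eq)
    (h5 : realPeriodRat_eq_unit_mul_plusPeriod) (h3 : realPeriodRat_eq_unit_mul_plusPeriod_three)
    (hmodP : nonempty_modularParametrizationData) (hmod : hasEntireLFunction_rat)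
    (hGZK : rank_eq_analyticRank_of_analyticRank_le_one)
    (hp : p ≠ 2) (hX : ClassX6 W p) (hr : W.analyticRank ≤ 1) (ε : ℤˣ)
    (hlow : KobayashiLowerDivisibility W p ε) : BSDp W p := by
  rcases Nat.le_one_iff_eq_zero_or_eq_one.mp hr with h0 | h1
  · exact X6.bsdp_of_kobayashiLowerDivisibility_of_analyticRank_eq_zero W p hW h12 hKim
      pollack_exists_plusMinusPAdicLFunction_holds hmodP hmod hGZK hp hX h0 hlow
  · exact X6.bsdp_of_lowerDivisibility_of_analyticRank_eq_one W p h12 h41 h5 h3 hA5 hmod hGZK hp hX h1 ε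
      hlow

/-! ### Class X7 on its surjective branch -/

/-- **X7 ∧ {r_an = 1}, odd `p`, `a_p = 0`, `ρ̄_{E,p}` onto: `BSD(E,p)` from ONE divisibility for ONE
sign** (good reduction is part of X7; `a_p = 0` is a hypothesis only at `p = 3` — `a_3 = ±3` is class
X8; surjectivity is NOT automatic for a non-semistable curve and is asked).
[cite: Kobayashi2003, Conjecture (p. 2), Thm. 1.2, Thm. 4.1 (p. 8)] [cite: BurungaleKobayashiOta2023, App. A Cor. A.5] -/
theorem X7.bsdp_of_lowerDivisibility_of_surj_of_analyticRank_eq_one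
    (h12 : Kobayashi2003.thm12_signedSelmerDual_finite_torsion)
    (h41 : Kobayashi2003.thm41_signedCharIdeal_divisibility)
    (h5 : realPeriodRat_eq_unit_mul_plusPeriod) (h3 : realPeriodRat_eq_unit_mul_plusPeriod_three)
    (hA5 : corA5_pPart_of_signedCharIdeal_eq) (hmod : hasEntireLFunction_rat)
    (hGZK : rank_eq_analyticRank_of_analyticRank_le_one)
    (hp : p ≠ 2) (hX : ClassX7 W p) (hap : W.frobeniusTrace p = 0) (hs : Surj W p)
    (h1 : W.analyticRank = 1) (ε : ℤˣ) (hlow : KobayashiLowerDivisibility W p ε) : BSDp W p :=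
  bsdp_of_lowerDivisibility_of_thm41_of_corA5_of_analyticRank_eq_one W p h12 h41 h5 h3 hA5 hmod hGZK hp
    hX.1.1 hap hs h1 ε hlow

/-- **CLASS X7 ON ITS SURJECTIVE BRANCH, BOTH RANKS, FROM ONE DIVISIBILITY.** For every X7 pair — good
SUPERSINGULAR odd `p`, `E` NOT semistable — with `a_p = 0` (automatic at `p ≥ 5`), `ρ̄_{E,p}` onto and
`r_an ≤ 1`: `BSD(E,p)` granted ONE typed input `KobayashiLowerDivisibility W p ε` (one sign; Kobayashi's
conjecture at a non-semistable curve — in print a conjecture only) and the published named facts of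
`X6.bsdp_of_lowerDivisibility`. Rank `0`: x10b's
`X7.bsdp_of_kobayashiLowerDivisibility_of_surj_of_analyticRank_eq_zero`; rank `1`:
`X7.bsdp_of_lowerDivisibility_of_surj_of_analyticRank_eq_one`. RESIDUAL-MAP §B N5/O4 on the surjective
branch as ONE kernel statement; X7 stays CONSTRUCTION-SHAPED (nothing booked).
[cite: Kobayashi2003, Conjecture (p. 2), Thm. 1.2, Thm. 4.1 (p. 8)] [cite: Wuthrich2014, Prop. 21 (p. 400)]
[cite: BDKim2013, Cor. 3.15 (p. 199)] [cite: BurungaleKobayashiOta2023, App. A Cor. A.5] [cite: Miller2011LMS, Def. 1.1] -/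
theorem X7.bsdp_of_lowerDivisibility_of_surj
    (hW : Wuthrich2014.sha_dvd_analyticSha)
    (h12 : Kobayashi2003.thm12_signedSelmerDual_finite_torsion)
    (h41 : Kobayashi2003.thm41_signedCharIdeal_divisibility)
    (hKim : BDKim2013.cor315_signedCharValue_rankZero)
    (hA5 : corA5_pPart_of_signedCharIdeal_eq)
    (h5 : realPeriodRat_eq_unit_mul_plusPeriod) (h3 : realPeriodRat_eq_unit_mul_plusPeriod_three)
    (hmodP : nonempty_modularParametrizationData) (hmod : hasEntireLFunction_rat)
    (hGZK : rank_eq_analyticRank_of_analyticRank_le_one)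
    (hp : p ≠ 2) (hX : ClassX7 W p) (hap : W.frobeniusTrace p = 0) (hs : Surj W p)
    (hr : W.analyticRank ≤ 1) (ε : ℤˣ) (hlow : KobayashiLowerDivisibility W p ε) : BSDp W p := by
  rcases Nat.le_one_iff_eq_zero_or_eq_one.mp hr with h0 | h1
  · exact X7.bsdp_of_kobayashiLowerDivisibility_of_surj_of_analyticRank_eq_zero W p hW h12 hKim
      pollack_exists_plusMinusPAdicLFunction_holds hmodP hmod hGZK hp hX hap hs h0 hlow
  · exact X7.bsdp_of_lowerDivisibility_of_surj_of_analyticRank_eq_one W p h12 h41 h5 h3 hA5 hmod hGZK hp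
      hX hap hs h1 ε hlow

/-- **X7 ∧ `p ≥ 5`, surjective branch, both ranks** (`a_p = 0` by Hasse:
`ClassX7.frobeniusTrace_eq_zero_of_five_le`). [cite: Kobayashi2003, Conjecture (p. 2), Thm. 4.1 (p. 8)]
[cite: Serre1981, §8.1–8.2 (pp. 188–189)] -/
theorem X7.bsdp_of_lowerDivisibility_of_surj_of_five_le
    (hW : Wuthrich2014.sha_dvd_analyticSha)
    (h12 : Kobayashi2003.thm12_signedSelmerDual_finite_torsion)
    (h41 : Kobayashi2003.thm41_signedCharIdeal_divisibility)
    (hKim : BDKim2013.cor315_signedCharValue_rankZero)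
    (hA5 : corA5_pPart_of_signedCharIdeal_eq)
    (h5 : realPeriodRat_eq_unit_mul_plusPeriod) (h3 : realPeriodRat_eq_unit_mul_plusPeriod_three)
    (hmodP : nonempty_modularParametrizationData) (hmod : hasEntireLFunction_rat)
    (hGZK : rank_eq_analyticRank_of_analyticRank_le_one)
    (hp5 : 5 ≤ p) (hX : ClassX7 W p) (hs : Surj W p) (hr : W.analyticRank ≤ 1) (ε : ℤˣ)
    (hlow : KobayashiLowerDivisibility W p ε) : BSDp W p :=
  X7.bsdp_of_lowerDivisibility_of_surj W p hW h12 h41 hKim hA5 h5 h3 hmodP hmod hGZK (by omega) hX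
    (ClassX7.frobeniusTrace_eq_zero_of_five_le W p hp5 hX) hs hr ε hlow

end Summit.BirchSwinnertonDyer.Rank1Residual.Supersingular

end
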